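import Literature.NumberTheory.Automorphic.LanglandsTetrahedralProofs
import Literature.NumberTheory.Automorphic.TunnellOctahedralGlobalProofs
import Literature.NumberTheory.Automorphic.RankinSelbergTowerFiniteness
import HarnessLib

/-!
# Arthur–Clozel, Ch. 3, Thm. 3.1 (quadratic case, Borel–Jacquet data): towards
# `ArthurClozel_fibres_quadratic_holds`

Topic `NumberTheory/Automorphic`; namespace `Literature.NumberTheory.Automorphic`. Proof file
(theorems only: no definition, no named fact), sibling of `ArthurClozelFibresRepData`, which reduces
the named fact `ArthurClozel_fibres_quadratic` of `TunnellLemma` (Arthur–Clozel 1989, Ch. 3, Thm. 3.1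
for a quadratic extension `M/K`, at the level of Hecke matrices, for cuspidal automorphic
representations of `GL_n(𝔸_K)` in the Borel–Jacquet model) to standard leaves
(`ArthurClozel_fibres_quadratic_of_normalisation`). This file feeds the leaves that are meanwhile
**theorems** of the tree:

* the automorphic measure on `GL_n(𝔸_K) ⧸ A_G GL_n(K)` — Borel–Harish-Chandra finiteness,
  `AdelicGroupData.exists_isAutomorphicMeasure_gl_holds` (`AdelicGroupDataAutomorphicMeasureProofs`);
* Jacquet–Shalika (2.1) = Thm. (5.3) of *Euler products I*: the partial Rankin–Selberg Euler product
  of two unitary cuspidal representations is multipliable on `re s > 1`,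
  `JacquetShalika1981_multipliable_partialPairL_holds` (`RankinSelbergTowerFiniteness`);
* the quadratic Hecke character `η_{M/K}` with `η(ϖ_w) = ε_{M/K}(w)` a.e. (Arthur–Clozel p. 201:
  "`ζ_v = η(ϖ_v)` … is a root of unity of order `f_v`"), unconditionally from Artin reciprocity for
  the quadratic extension, `exists_heckeCharacter_quadraticSign_of_finrank_eq_two`
  (`TunnellOctahedralGlobalProofs`) — replacing the leaf `artinReciprocity_character`;

and it takes the clean-model input of the unitary normalisation ("We may assume `π, π'` unitary",
Borel–Jacquet 1979, 5.7) in the weak, true form shared with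
`JacquetShalika_eq_of_rsData_eq_of_L2` (`LanglandsTetrahedralProofs`): every cuspidal datum has the
Satake parameters of some clean cuspidal datum (`W₀' = ⊥`). (The complement form
`cuspidal_W'_eq_bot` consumed by the older `ArthurClozel_fibres_quadratic_of_leaves` is refuted in
the tree, `AutomorphicRepsGLLogDetCounterexample`: Borel–Jacquet's cusp forms without central
character are not semisimple under `A_G`.)

Result: `ArthurClozel_fibres_quadratic_of_leaves'` — the fact granted the remaining inputs, each of
the first six still a named fact of the tree without discharge: Jacquet–Shalika (2.2) at `s = 1` and
on the line `re s = 1`, and (2.3) (`JacquetShalika1981_partialPairL_at_one_of_ne_conj`,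
`…_boundary_of_ne_one`, `…_pole_of_eq_conj`; *Euler products II*, Prop. 3.6), multiplicity one on
`L²_cusp(GL_n)` (`multiplicity_one_gl`), the Borel–Jacquet dictionary for `A_G`-invariant data
(`AutomorphicRepsGL.exists_isAssociatedL2`, `hasSatakeParamAt_iff_L2`), and the clean models. The
discharge `ArthurClozel_fibres_quadratic_holds` is `ArthurClozel_fibres_quadratic_of_leaves'` fed with
their proofs, once they exist.

## References

* J. Arthur, L. Clozel, *Simple algebras, base change, and the advanced theory of the trace
  formula*, Ann. of Math. Stud. 120 (1989), Ch. 3 §2 (2.1)–(2.3) (p. 200), Thm. 3.1 and its proof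
  (p. 201). [ArthurClozelAMS120]
* A. Borel, H. Jacquet, *Automorphic forms and automorphic representations*, Proc. Sympos. Pure
  Math. 33 (1979), part 1, §4.6, 5.7. [BorelJacquetCorvallis1979]
* H. Jacquet, J. A. Shalika, *On Euler products and the classification of automorphic
  representations I*, Amer. J. Math. 103 (1981), 499–558, Thm. (5.3). [JacquetShalikaAJM1981]
* A. Borel, *Some finiteness properties of adele groups over number fields*, Publ. Math. IHÉS 16
  (1963), Thm. 5.8. [Borel1963]
-/

noncomputable section

open scoped MatrixGroups NNReal Classical
open NumberField IsDedekindDomain MeasureTheory Filter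

namespace Literature.NumberTheory.Automorphic

open AdelicGroupData

/-- **Arthur–Clozel, Ch. 3, Thm. 3.1 (quadratic case, Borel–Jacquet data) from the open leaves.**
Granting, for all `GL_n` over all number fields and all automorphic measures: Jacquet–Shalika (2.2)
(`h22`: `L^S(s, π × π̃')` has a finite limit at `s = 1` for `π' ≠ π`; `h22'`: a finite limit at every
`1 + it`, `t ≠ 0`) and (2.3) (`h23`: a pole at `s = 1` for `π' = π`), multiplicity one on
`L²_cusp(GL_n)` (`hm1`), the Borel–Jacquet dictionary between `A_G`-invariant cuspidal data and
`L²_cusp` (`hA`, `hL2`) and clean models (`hcl`: every cuspidal datum `π` has the Satake parameters of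
a cuspidal datum `π₀` realised on a subspace, `W₀' = ⊥` — the form shared with
`JacquetShalika_eq_of_rsData_eq_of_L2`): for a quadratic extension `M/K` and cuspidal automorphic
representations `π, π'` of `GL_n(𝔸_K)` with `t_{π,w}^{f(x|w)} = t_{π',w}^{f(x|w)}` for almost all
places `x` of `M`, either `t_{π'} = t_π` a.e. or `t_{π',w} = ε_{M/K}(w) t_{π,w}` a.e. — the named fact
`ArthurClozel_fibres_quadratic`. This is `ArthurClozel_fibres_quadratic_of_normalisation` with the
proved leaves fed in — the automorphic measure (`AdelicGroupData.exists_isAutomorphicMeasure_gl_holds`),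
Jacquet–Shalika (2.1) (`JacquetShalika1981_multipliable_partialPairL_holds`), the quadratic characters
`η_{M/K}` (`exists_heckeCharacter_quadraticSign_of_finrank_eq_two`) — and the normalisation "We may
assume `π` unitary" by `CuspidalAutomorphicRepData.exists_satake_eq_cpow_mul_L2_of_clean`.
[cite: ArthurClozelAMS120, Ch. 3, Thm. 3.1 and its proof (p. 201)] -/
theorem ArthurClozel_fibres_quadratic_of_leaves'
    (h22 : ∀ {n : ℕ} {K : Type} [Field K] [NumberField K] {μ : Measure (gl n K).automorphicQuotient}
      [(gl n K).IsAutomorphicMeasure μ],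
      JacquetShalika1981_partialPairL_at_one_of_ne_conj (n := n) (K := K) (μ := μ))
    (h22' : ∀ {n : ℕ} {K : Type} [Field K] [NumberField K] {μ : Measure (gl n K).automorphicQuotient}
      [(gl n K).IsAutomorphicMeasure μ],
      JacquetShalika1981_partialPairL_boundary_of_ne_one (n := n) (m := n) (K := K) (μ := μ) (μ' := μ))
    (h23 : ∀ {n : ℕ} {K : Type} [Field K] [NumberField K] {μ : Measure (gl n K).automorphicQuotient}
      [(gl n K).IsAutomorphicMeasure μ],
      JacquetShalika1981_partialPairL_pole_of_eq_conj (n := n) (K := K) (μ := μ))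
    (hm1 : ∀ (n : ℕ) (K : Type) [Field K] [NumberField K] (μ : Measure (gl n K).automorphicQuotient)
      [(gl n K).IsAutomorphicMeasure μ], multiplicity_one_gl n K μ)
    (hA : ∀ {n : ℕ} {K : Type} [Field K] [NumberField K] (hK : isCompact_glFiniteIntegralLevel n K)
      (μ : Measure (gl n K).automorphicQuotient) [(gl n K).IsAutomorphicMeasure μ],
      AutomorphicRepsGL.exists_isAssociatedL2 hK μ)
    (hL2 : ∀ {n : ℕ} {K : Type} [Field K] [NumberField K] (hK : isCompact_glFiniteIntegralLevel n K)
      (μ : Measure (gl n K).automorphicQuotient) [(gl n K).IsAutomorphicMeasure μ],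
      hasSatakeParamAt_iff_L2 hK μ)
    (hcl : ∀ {n : ℕ} {K : Type} [Field K] [NumberField K] (hK : isCompact_glFiniteIntegralLevel n K)
      (π : CuspidalAutomorphicRepData n K hK), ∃ π₀ : CuspidalAutomorphicRepData n K hK,
        π₀.1.W' = ⊥ ∧ ∀ (v : HeightOneSpectrum (𝓞 K)) (β : Multiset ℂ),
          π₀.1.HasSatakeParamAt v β → π.1.HasSatakeParamAt v β) :
    ArthurClozel_fibres_quadratic :=
  ArthurClozel_fibres_quadratic_of_normalisation
    (fun n K _ _ => AdelicGroupData.exists_isAutomorphicMeasure_gl_holds n K)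
    JacquetShalika1981_multipliable_partialPairL_holds
    h22 h22' h23 hm1
    (fun hKM => by
      obtain ⟨ω, hωfin, hω⟩ := exists_heckeCharacter_quadraticSign_of_finrank_eq_two hKM
      exact ⟨ω, hωfin, hω.mono fun w hw => hw.2⟩)
    (fun hK μ _ π => by
      obtain ⟨π₀, h0W', h0π⟩ := hcl hK π
      exact CuspidalAutomorphicRepData.exists_satake_eq_cpow_mul_L2_of_clean (hA hK μ) (hL2 hK μ) π π₀
        h0W' h0π)

end Literature.NumberTheory.Automorphic

end
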